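import Literature.Algebra.Polynomial.TorusNormalForm
import HarnessLib

/-!
# Degree-bounded ideal certificates on the angle torus: a polynomial vanishing on `T^ι` is
# `Σ_i h_i (c_i² + s_i² − 1)` with `deg h_i ≤ deg p − 2` (division by a Gröbner basis whose
# leading terms are `c_i²`; Cox–Little–O'Shea Ch. 2 §3 Thm 3 / Ch. 5 §3 Prop. 1, torus instance)

Third companion of `TorusVanishingIdeal.lean` (`J := ⟨c_i² + s_i² − 1⟩ = I(T^ι)`) and
`TorusNormalForm.lean` (reduced normal forms modulo `J` exist and are unique).  Here the reduction
`c_i² ↦ (1 − s_i²) + (c_i² + s_i² − 1)` is carried out with DEGREE BOOKKEEPING, monomial by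
monomial, as in the division algorithm (Cox–Little–O'Shea Ch. 2 §3, Theorem 3: `f = Σ aᵢ fᵢ + r`
with «`multideg(aᵢ fᵢ) ≤ multideg(f)`» whenever `aᵢ fᵢ ≠ 0`; held copy p0078): since the rewriting
never raises total degree,

* `exists_isReduced_degree_le` — every `p` equals `r + Σ_i h_i · (c_i² + s_i² − 1)` with `r`
  reduced, `deg r ≤ deg p` and every monomial of every `h_i` of degree `≤ deg p − 2`;
* **`exists_certificate_degree_le_of_eval_eq_zero`** — if `p` vanishes on the angle torus `T^ι`,
  then `p = Σ_i h_i · (c_i² + s_i² − 1)` with `totalDegree h_i ≤ totalDegree p − 2` for all `i`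
  (the reduced part vanishes on `T^ι`, hence is `0` by `TorusNormalForm`);
* `exists_certificate_degree_le_of_eval_eq` — two polynomials agreeing on `T^ι` differ by such a
  combination with `deg h_i ≤ max (deg p) (deg q) − 2`.

So the equality constraints of the multi-angle polynomialisation (Cox–Little–O'Shea Ch. 6 §2 (5))
are complete WITH A DEGREE BOUND: an identity valid on `T^ι` between polynomials of degree `≤ d`
has an ideal certificate with multipliers of degree `≤ d − 2` — the multiplier block sizes a
certificate search must allow are determined by the degree of the claim alone.

No `sorry`, no new axioms, no named facts.
-/

noncomputable section

open MvPolynomial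

namespace Literature.Algebra.Polynomial.TorusIdealDegreeBound

open Literature.Algebra.Polynomial.TorusVanishingIdeal
open Literature.Algebra.Polynomial.TorusNormalForm

variable {κ : Type*}

/-! ## §1 Degrees of monomials and the cosine excess -/

/-- Monomials of a reduced family: if every monomial of `r` has degree `≤ D` then
`totalDegree r ≤ D`. [folklore] -/
private theorem totalDegree_le_of_forall_degree_le {r : MvPolynomial (κ × Fin 2) ℝ} {D : ℕ}
    (h : ∀ m ∈ r.support, Finsupp.degree m ≤ D) : r.totalDegree ≤ D :=
  Finset.sup_le fun m hm => h m hm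

/-- A monomial is reduced iff all its cosine exponents are `≤ 1`; `monomial m a` is then reduced.
[cite: CoxLittleOShea2007, Ch. 5 §3, Proposition 1 (p0253)] -/
theorem isReduced_monomial {m : κ × Fin 2 →₀ ℕ} (hm : ∀ i, m (i, 0) ≤ 1) (a : ℝ) :
    IsReduced (monomial m a) := by
  classical
  intro m' hm' i
  rw [support_monomial] at hm'
  split_ifs at hm' with ha
  · simp at hm'
  · rw [Finset.mem_singleton] at hm'
    subst hm'
    exact hm i

/-- Finite sums of reduced polynomials are reduced.
[cite: CoxLittleOShea2007, Ch. 5 §3, Proposition 1 (p0253)] -/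
theorem isReduced_sum {α : Type*} (s : Finset α) (f : α → MvPolynomial (κ × Fin 2) ℝ)
    (h : ∀ x ∈ s, IsReduced (f x)) : IsReduced (∑ x ∈ s, f x) :=
  Finset.sum_induction f IsReduced (fun _ _ ha hb => ha.add hb) isReduced_zero h

section Fintype

variable [Fintype κ] [DecidableEq κ]

/-- The cosine excess `Σ_i (m(c_i) − 1)₊` of a monomial: zero iff the monomial is reduced; it is
the quantity that strictly decreases under `c_i² ↦ 1 − s_i²`.
[cite: CoxLittleOShea2007, Ch. 2 §3, Theorem 3 (p0078)] -/
def cexcess (m : κ × Fin 2 →₀ ℕ) : ℕ := ∑ i, (m (i, 0) - 1)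

omit [DecidableEq κ] in
/-- Zero excess means reduced. [cite: CoxLittleOShea2007, Ch. 5 §3, Proposition 1 (p0253)] -/
theorem cexcess_eq_zero_iff (m : κ × Fin 2 →₀ ℕ) : cexcess m = 0 ↔ ∀ i, m (i, 0) ≤ 1 := by
  rw [cexcess, Finset.sum_eq_zero_iff]
  simp [Nat.sub_eq_zero_iff_le]

/-! ## §2 Reduction of one monomial with degree bookkeeping -/

/-- **One monomial, degree-bounded division by the `c_i² + s_i² − 1`.**  `a·x^m = r + Σ h_i rel_i`
with `r` reduced, every monomial of `r` of degree `≤ |m|` and every monomial of every `h_i` of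
degree `≤ |m| − 2` (induction on the cosine excess: `c_i² = (1 − s_i²) + rel_i`).
[cite: CoxLittleOShea2007, Ch. 2 §3, Theorem 3 (p0078); Ch. 5 §3, Proposition 1 (i) (p0253)] -/
theorem monomial_reduce (N : ℕ) : ∀ (m : κ × Fin 2 →₀ ℕ), cexcess m ≤ N → ∀ a : ℝ,
    ∃ (r : MvPolynomial (κ × Fin 2) ℝ) (h : κ → MvPolynomial (κ × Fin 2) ℝ),
      monomial m a = r + ∑ i, h i * rel κ i ∧ IsReduced r ∧
      (∀ m' ∈ r.support, Finsupp.degree m' ≤ Finsupp.degree m) ∧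
      (∀ i, ∀ m' ∈ (h i).support, Finsupp.degree m' + 2 ≤ Finsupp.degree m) := by
  induction N with
  | zero =>
    intro m hm a
    have hred : ∀ i, m (i, 0) ≤ 1 := (cexcess_eq_zero_iff m).1 (Nat.le_zero.1 hm)
    refine ⟨monomial m a, 0, by simp, isReduced_monomial hred a, fun m' hm' => ?_, fun i m' hm' => ?_⟩
    · rw [support_monomial] at hm'
      split_ifs at hm'
      · simp at hm'
      · rw [Finset.mem_singleton.1 hm']
    · simp at hm'
  | succ N IH =>
    intro m hm a
    by_cases h0 : cexcess m = 0
    · exact IH m (by omega) a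
    -- pick a cosine with exponent ≥ 2
    obtain ⟨i, hi⟩ : ∃ i, 2 ≤ m (i, 0) := by
      by_contra hcon
      push Not at hcon
      exact h0 ((cexcess_eq_zero_iff m).2 fun i => by have := hcon i; omega)
    -- `m = m' + 2·e_{c_i}`, `m'' = m' + 2·e_{s_i}`
    set m' : κ × Fin 2 →₀ ℕ := m - Finsupp.single (i, 0) 2 with hm'def
    set m'' : κ × Fin 2 →₀ ℕ := m' + Finsupp.single (i, 1) 2 with hm''def
    have hle : Finsupp.single (i, 0) 2 ≤ m := Finsupp.single_le_iff.2 hi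
    have hm_eq : m = m' + Finsupp.single (i, 0) 2 := by
      rw [hm'def, tsub_add_cancel_of_le hle]
    -- excess bookkeeping
    have hm'i : m' (i, 0) = m (i, 0) - 2 := by
      rw [hm'def, Finsupp.tsub_apply, Finsupp.single_eq_same]
    have hm'j : ∀ j, j ≠ i → m' (j, 0) = m (j, 0) := fun j hj => by
      have hne : ((i, (0 : Fin 2)) : κ × Fin 2) ≠ (j, 0) := by simpa using Ne.symm hj
      rw [hm'def, Finsupp.tsub_apply, Finsupp.single_eq_of_ne (Ne.symm hne), Nat.sub_zero]
    have hexc' : cexcess m' ≤ N := by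
      have hlt : cexcess m' < cexcess m := by
        unfold cexcess
        apply Finset.sum_lt_sum
        · intro j _
          by_cases hj : j = i
          · subst hj; rw [hm'i]; omega
          · rw [hm'j j hj]
        · exact ⟨i, Finset.mem_univ _, by rw [hm'i]; omega⟩
      omega
    have hm''c : ∀ j, m'' (j, 0) = m' (j, 0) := fun j => by
      have hne : ((i, (1 : Fin 2)) : κ × Fin 2) ≠ (j, 0) := by simp
      rw [hm''def, Finsupp.add_apply, Finsupp.single_eq_of_ne (Ne.symm hne), add_zero]
    have hexc'' : cexcess m'' ≤ N := by
      have : cexcess m'' = cexcess m' := Finset.sum_congr rfl fun j _ => by rw [hm''c]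
      rw [this]; exact hexc'
    -- degrees
    have hdeg' : Finsupp.degree m = Finsupp.degree m' + 2 := by
      rw [hm_eq, map_add, Finsupp.degree_single]
    have hdeg'' : Finsupp.degree m'' = Finsupp.degree m := by
      rw [hm''def, map_add, Finsupp.degree_single, hdeg']
    -- the rewriting identity
    have hsplit : (monomial m a : MvPolynomial (κ × Fin 2) ℝ) =
        monomial m' a + monomial m'' (-a) + monomial m' a * rel κ i := by
      have h1 : (monomial m a : MvPolynomial (κ × Fin 2) ℝ) = monomial m' a * X (i, 0) ^ 2 := by
        rw [X_pow_eq_monomial, monomial_mul, mul_one, ← hm_eq]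
      have h2 : (monomial m'' (-a) : MvPolynomial (κ × Fin 2) ℝ) = -(monomial m' a * X (i, 1) ^ 2) := by
        rw [X_pow_eq_monomial, monomial_mul, mul_one, ← hm''def, map_neg]
      rw [h1, h2, rel]
      ring
    -- recurse
    obtain ⟨r₁, h₁, e₁, hr₁, hd₁, hh₁⟩ := IH m' hexc' a
    obtain ⟨r₂, h₂, e₂, hr₂, hd₂, hh₂⟩ := IH m'' hexc'' (-a)
    refine ⟨r₁ + r₂, fun j => h₁ j + h₂ j + if j = i then monomial m' a else 0, ?_, hr₁.add hr₂,
      fun n hn => ?_, fun j n hn => ?_⟩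
    · -- the identity
      have hsum : ∑ j, (h₁ j + h₂ j + if j = i then monomial m' a else 0) * rel κ j =
          ∑ j, h₁ j * rel κ j + ∑ j, h₂ j * rel κ j + monomial m' a * rel κ i := by
        simp only [add_mul, Finset.sum_add_distrib, ite_mul, zero_mul, Finset.sum_ite_eq',
          Finset.mem_univ, if_true]
      rw [hsum]
      linear_combination hsplit + e₁ + e₂
    · -- degrees of the reduced part
      rcases Finset.mem_union.1 (support_add hn) with hn | hn
      · exact (hd₁ n hn).trans (by rw [hdeg']; omega)
      · rw [← hdeg'']; exact hd₂ n hn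
    · -- degrees of the multipliers
      rcases Finset.mem_union.1 (support_add hn) with hn | hn
      · rcases Finset.mem_union.1 (support_add hn) with hn | hn
        · exact (hh₁ j n hn).trans (by rw [hdeg']; omega)
        · rw [← hdeg'']; exact hh₂ j n hn
      · by_cases hj : j = i
        · rw [if_pos hj, support_monomial] at hn
          split_ifs at hn
          · simp at hn
          · rw [Finset.mem_singleton.1 hn, hdeg']
        · rw [if_neg hj] at hn
          simp at hn

/-! ## §3 Degree-bounded reduction of a polynomial -/

/-- **Degree-bounded reduced representative**: `p = r + Σ_i h_i · (c_i² + s_i² − 1)` with `r`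
reduced, `deg r ≤ deg p`, and all monomials of the `h_i` of degree `≤ deg p − 2` (reduce each
monomial of `p` separately, so no cancellation can spoil the bound).
[cite: CoxLittleOShea2007, Ch. 2 §3, Theorem 3 (p0078); Ch. 5 §3, Proposition 1 (i) (p0253)] -/
theorem exists_isReduced_degree_le (p : MvPolynomial (κ × Fin 2) ℝ) :
    ∃ (r : MvPolynomial (κ × Fin 2) ℝ) (h : κ → MvPolynomial (κ × Fin 2) ℝ),
      p = r + ∑ i, h i * rel κ i ∧ IsReduced r ∧ r.totalDegree ≤ p.totalDegree ∧
      ∀ i, ∀ m' ∈ (h i).support, Finsupp.degree m' + 2 ≤ p.totalDegree := by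
  choose R H hRH hR hRd hHd using fun m : κ × Fin 2 →₀ ℕ => monomial_reduce (cexcess m) m le_rfl
  refine ⟨∑ m ∈ p.support, R m (coeff m p), fun i => ∑ m ∈ p.support, H m (coeff m p) i, ?_,
    isReduced_sum _ _ fun m _ => hR m _, ?_, fun i m' hm' => ?_⟩
  · -- identity
    conv_lhs => rw [as_sum p]
    rw [Finset.sum_congr rfl fun m _ => hRH m (coeff m p), Finset.sum_add_distrib]
    congr 1
    rw [Finset.sum_comm]
    exact Finset.sum_congr rfl fun i _ => by rw [Finset.sum_mul]
  · -- degree of the reduced part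
    refine totalDegree_finsetSum_le fun m hm => ?_
    exact totalDegree_le_of_forall_degree_le fun m' hm' =>
      (hRd m _ m' hm').trans (le_totalDegree hm)
  · -- degrees of the multipliers
    classical
    obtain ⟨m, hm, hm'⟩ := Finset.mem_biUnion.1 (support_sum hm')
    exact (hHd m _ i m' hm').trans (le_totalDegree hm)

/-- **Degree-bounded ideal certificate for the angle torus.**  If `p` vanishes on `T^ι` then
`p = Σ_i h_i · (c_i² + s_i² − 1)` with `totalDegree h_i ≤ totalDegree p − 2` for every `i`: the
reduced part of the degree-bounded reduction vanishes on `T^ι` and is therefore `0`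
(`TorusNormalForm.eq_zero_of_isReduced_of_eval_eq_zero`).
[cite: CoxLittleOShea2007, Ch. 5 §3, Proposition 1 (p0253); Ch. 2 §3, Theorem 3 (p0078); Ch. 6 §2,
eq. (5) (p0310)] -/
theorem exists_certificate_degree_le_of_eval_eq_zero {p : MvPolynomial (κ × Fin 2) ℝ}
    (hp : ∀ v ∈ torus κ, eval v p = 0) :
    ∃ h : κ → MvPolynomial (κ × Fin 2) ℝ,
      p = ∑ i, h i * rel κ i ∧ ∀ i, (h i).totalDegree ≤ p.totalDegree - 2 := by
  obtain ⟨r, h, hp', hr, -, hh⟩ := exists_isReduced_degree_le p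
  have hmem : ∑ i, h i * rel κ i ∈ torusIdeal κ :=
    Ideal.sum_mem _ fun i _ => Ideal.mul_mem_left _ _ (rel_mem_torusIdeal i)
  have hr0 : r = 0 := by
    refine eq_zero_of_isReduced_of_eval_eq_zero hr fun v hv => ?_
    have h1 := hp v hv
    rw [hp', map_add, eval_eq_zero_of_mem_torusIdeal hmem hv, add_zero] at h1
    exact h1
  refine ⟨h, by rw [hp', hr0, zero_add], fun i => ?_⟩
  exact totalDegree_le_of_forall_degree_le fun m' hm' => by
    have := hh i m' hm'
    omega

/-- Two polynomials that agree on `T^ι` differ by an ideal combination with multipliers of degree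
`≤ max (deg p) (deg q) − 2`. [cite: CoxLittleOShea2007, Ch. 5 §3, Proposition 1 (p0253); Ch. 6
§2, eq. (5) (p0310)] -/
theorem exists_certificate_degree_le_of_eval_eq {p q : MvPolynomial (κ × Fin 2) ℝ}
    (hpq : ∀ v ∈ torus κ, eval v p = eval v q) :
    ∃ h : κ → MvPolynomial (κ × Fin 2) ℝ,
      p - q = ∑ i, h i * rel κ i ∧ ∀ i, (h i).totalDegree ≤ max p.totalDegree q.totalDegree - 2 := by
  obtain ⟨h, hh, hdeg⟩ := exists_certificate_degree_le_of_eval_eq_zero (p := p - q) fun v hv => by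
    rw [map_sub, hpq v hv, sub_self]
  refine ⟨h, hh, fun i => (hdeg i).trans ?_⟩
  exact Nat.sub_le_sub_right (totalDegree_sub p q) 2

end Fintype

/-- The `Finite` packaging of the main theorem.
[cite: CoxLittleOShea2007, Ch. 5 §3, Proposition 1 (p0253)] -/
theorem exists_certificate_degree_le_of_eval_eq_zero' [Finite κ] {p : MvPolynomial (κ × Fin 2) ℝ}
    (hp : ∀ v ∈ torus κ, eval v p = 0) :
    ∃ (s : Finset κ) (h : κ → MvPolynomial (κ × Fin 2) ℝ),
      p = ∑ i ∈ s, h i * rel κ i ∧ ∀ i, (h i).totalDegree ≤ p.totalDegree - 2 := by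
  classical
  cases nonempty_fintype κ
  obtain ⟨h, hh, hdeg⟩ := exists_certificate_degree_le_of_eval_eq_zero hp
  exact ⟨Finset.univ, h, hh, hdeg⟩

section Certificates

variable [Fintype κ] [DecidableEq κ]

/-- **Degree-bounded multipliers for certificates modulo `J`.**  If `p − s ∈ J` (e.g. `s` a sum of
squares certifying `p ≥ 0` on `T^ι`, as in `TorusPositivstellensatz`), then the ideal part can be
taken with multipliers of degree `≤ max (deg p) (deg s) − 2`:
`p = s + Σ_i h_i · (c_i² + s_i² − 1)`, `totalDegree h_i ≤ max p.totalDegree s.totalDegree − 2` —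
the multiplier blocks of a kernel certificate «`p = SOS + Σ h_i rel_i`» are sized by the degrees
of `p` and of the SOS part alone.
[cite: CoxLittleOShea2007, Ch. 2 §3, Theorem 3 (p0078); Ch. 5 §3, Proposition 1 (p0253)] -/
theorem exists_certificate_degree_le_of_sub_mem_torusIdeal {p s : MvPolynomial (κ × Fin 2) ℝ}
    (h : p - s ∈ torusIdeal κ) :
    ∃ hm : κ → MvPolynomial (κ × Fin 2) ℝ,
      p = s + ∑ i, hm i * rel κ i ∧
        ∀ i, (hm i).totalDegree ≤ max p.totalDegree s.totalDegree - 2 := by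
  obtain ⟨hm, hh, hdeg⟩ := exists_certificate_degree_le_of_eval_eq (p := p) (q := s)
    fun v hv => by
      have h0 := eval_eq_zero_of_mem_torusIdeal h hv
      rwa [map_sub, sub_eq_zero] at h0
  exact ⟨hm, by rw [← hh]; ring, hdeg⟩

/-- In particular, for a polynomial `p` of degree `≤ d` and a sum of squares `s` of degree `≤ d`
with `p ≡ s (mod J)`: `p = s + Σ_i h_i rel_i` with all `deg h_i ≤ d − 2`.
[cite: CoxLittleOShea2007, Ch. 2 §3, Theorem 3 (p0078); Ch. 5 §3, Proposition 1 (p0253)] -/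
theorem exists_certificate_degree_le_of_sub_mem_torusIdeal_le {p s : MvPolynomial (κ × Fin 2) ℝ}
    {d : ℕ} (hp : p.totalDegree ≤ d) (hs : s.totalDegree ≤ d) (h : p - s ∈ torusIdeal κ) :
    ∃ hm : κ → MvPolynomial (κ × Fin 2) ℝ,
      p = s + ∑ i, hm i * rel κ i ∧ ∀ i, (hm i).totalDegree ≤ d - 2 := by
  obtain ⟨hm, hh, hdeg⟩ := exists_certificate_degree_le_of_sub_mem_torusIdeal h
  exact ⟨hm, hh, fun i => (hdeg i).trans (Nat.sub_le_sub_right (max_le hp hs) 2)⟩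

end Certificates

end Literature.Algebra.Polynomial.TorusIdealDegreeBound

end
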